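import Literature.NumberTheory.DiophantineGeometry.LooperUniformBoundedness
import Literature.NumberTheory.DiophantineGeometry.AbcImpliesHall
import HarnessLib

/-!
# Proof of Looper's Theorem 1.2 over `ℚ` for `d ≥ 5` (`looper2021_holds`)

This file discharges the named fact `Literature.NumberTheory.DiophantineGeometry.looper2021`
(`LooperUniformBoundedness.lean`): N. R. Looper, *Dynamical uniform boundedness and the
abc-conjecture*, Invent. Math. 225 (2021) 1–44, Theorem 1.2, in the case `K = ℚ`, `d ≥ 5`:

> assuming the abc conjecture over `ℚ`, for every `d ≥ 5` there is `B = B(d)` such that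
> `z ↦ z ^ d + c` has at most `B` rational preperiodic points, for every `c ∈ ℚ`.

No statement or definition of `LooperUniformBoundedness.lean` is changed; this file only adds
theorems (helpers in the sub-namespace `Looper2021`, named after the paper).

## The published proof and the proof given here

Looper's proof for `d ≥ 5` (§8 of the paper, read on the held arXiv text, pp. 20–21) is "purely
algebraic": with `f = z^d + c` over a number field `K`,
* Lemma 8.1 (Ingram): points of canonical local height `0` lie in `D(0, 2_v|c|_v^{1/d})` at every
  place `v`;
* Lemma 8.2: `h(p₁ − p₂) ≤ h(c)/d + log 4` for preperiodic `p₁, p₂`;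
* Lemma 8.3: distinct periodic points *in a common cycle* have coprime "numerators";
* Prop. 8.4: for such `p₁, p₂` the point `P = (p₁^d : p₂^d : f(p₁) − f(p₂))` of the line
  `Z₁ − Z₂ = Z₃` has `h(P) ≥ ((d−1−ξ)/d) h(c) + rad(f(p₁) − f(p₂)) − η`;
* proof of Thm. 1.2 (p. 21): if the archimedean places and the places above `d` carry at most a
  proportion `ξ` of `h(c)`, then `rad(P) ≤ (3/d) h(c) + 2 log 2 + rad(f(p₁) − f(p₂))`, so
  `h(P) − (1+ε) rad(P) ≥ ((d−4−ξ−4ε)/d) h(c) − O(1)`, contradicting abc for `h(c) ≫ 1` when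
  `d ≥ 5`; Northcott bounds the remaining `c`; this bounds cycle lengths, and Doyle–Poonen's theorem
  (preperiodic uniform boundedness follows from periodic) finishes; the complementary case (a
  bounded set of places dominates `h(c)`) is Prop. 4.1 (§4), proved by nonarchimedean/complex
  potential theory (equidistribution, transfinite diameter, Prop. 4.2).

Over `K = ℚ` the same architecture closes *elementarily*, and that is what is formalized:
* **Local boxes** (= Lemma 8.1 at each place of `ℚ`), from one *no-escape lemma*
  (`not_isPreperiodicPt_of_increasing`: a potential that increases strictly along an orbit rules
  out preperiodicity): `|z|^d ≤ 2|c| ∨ |z| ≤ 2` at `∞` and `‖z‖_p ≤ max(1, ‖c‖_p^{1/d})` with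
  equality `‖z‖_p^d = ‖c‖_p` when `‖c‖_p > 1`. Globally: `den(z)^d = den(c)` for every rational
  preperiodic `z` (`den_pow_eq_den_of_mem_ratPreperiodicPts`), so all of them are `x/e` with a
  common `e`, `c = a/e^d`, and `|x|^d ≤ 2|a| ∨ |x| ≤ 2e` (= Lemma 8.2).
* **Main case** `|a| ≤ e^{d+1}` (the archimedean place carries a proportion `≤ 1/(d+1)` of
  `h(c) = log max(|a|, e^d)`; over `ℚ` the places above `d` need no separate treatment):
  for preperiodic `z₁ ≠ ±z₂` the relation `x₁^d − x₂^d = e^{d−1}(x₁' − x₂')` (Prop. 8.4's triple)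
  is divided by `g^d`, `g = gcd(x₁, x₂)` (prime to `e`) — this replaces Lemma 8.3, so *any* two
  preperiodic points may be used and the reduction to cycles, hence Doyle–Poonen, is not needed —
  and abc with `ε = 1/10` plus the radical bound `rad ≤ |y₁||y₂| e |w|` give, in logarithms, exactly
  the bookkeeping of p. 21: `(d² − 4.4 d − 2.3) log e < d (log C + 2.4 log 2)` (`caseA_arith`),
  whence `e`, `|c| ≤ e` and (box count `encard_le_box`, the role of Northcott) the number of
  preperiodic points are bounded in terms of `d` and `C`.
* **Easier case** `|a| > e^{d+1}` (= Prop. 4.1 with `S = {∞}`): if moreover `|c| ≥ 2^{d+3}`, the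
  map expands distances between same-sign preperiodic points by `Λ = |c|/(2R)`, `R = (2|c|)^{1/d}`
  (`expand_step_of_mem_ratPreperiodicPts`), preperiodic points are `1/e`-separated and confined to
  `[−R, R]`, so the 3-step sign itinerary is injective and there are at most `8` points
  (`encard_ratPreperiodicPts_le_eight`); if `|c| < 2^{d+3}` then `e < |c|` is bounded and the box
  count applies.
The final constant is `B(d) = max 8 (4N₀² + 1)`, `N₀ = max(⌈exp(d(log C + 2.4 log 2)/0.7)⌉,
2^{d+3}, 1)` where `C = C(1/10)` is the abc constant.

Design: everything is proved for the tree's objects `unicritical`, `ratPreperiodicPts`,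
`IsPreperiodicPt`, `IsABCTriple`, `rad` (no new definitions); `p`-adic sizes via Mathlib's
`padicNorm`; the abc step reuses `radical_le_of_dvd_pow` from `AbcImpliesHall.lean`.
-/

namespace Literature.NumberTheory.DiophantineGeometry

open Function Set UniqueFactorizationMonoid

/-! ### Preperiodic points are forward invariant -/

/-- The image of a preperiodic point is preperiodic (same cycle). [folklore] -/
theorem IsPreperiodicPt.apply {α : Type*} {f : α → α} {x : α} (h : IsPreperiodicPt f x) :
    IsPreperiodicPt f (f x) := by
  obtain ⟨n, hn⟩ := h
  obtain ⟨k, hk, hkx⟩ := mem_periodicPts.1 hn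
  refine ⟨n, mem_periodicPts.2 ⟨k, hk, ?_⟩⟩
  rw [← iterate_succ_apply, iterate_succ_apply']
  exact hkx.apply

/-- Every iterate of a preperiodic point is preperiodic. [folklore] -/
theorem IsPreperiodicPt.iterate {α : Type*} {f : α → α} {x : α} (h : IsPreperiodicPt f x) (m : ℕ) :
    IsPreperiodicPt f (f^[m] x) := by
  induction m with
  | zero => simpa using h
  | succ m ih => rw [iterate_succ_apply']; exact ih.apply

namespace Looper2021

/-! ### The no-escape lemma -/

/-- A forward-invariant set contains the forward orbit of each of its points. [folklore] -/
theorem iterate_mem_of_mapsTo {α : Type*} {f : α → α} {S : Set α}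
    (hS : ∀ z ∈ S, f z ∈ S) {x : α} (hx : x ∈ S) (n : ℕ) : f^[n] x ∈ S := by
  induction n with
  | zero => simpa using hx
  | succ n ih => rw [iterate_succ_apply']; exact hS _ ih

/-- If a potential `N` (values in a preorder) strictly increases under `f` on a forward-
invariant set `S`, then `N x < N (f^[n+1] x)` for `x ∈ S`. [folklore] -/
theorem lt_iterate_succ_of_increasing {α β : Type*} [Preorder β] {f : α → α} {S : Set α}
    (hS : ∀ z ∈ S, f z ∈ S) (N : α → β) (hN : ∀ z ∈ S, N z < N (f z)) {x : α} (hx : x ∈ S)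
    (n : ℕ) : N x < N (f^[n + 1] x) := by
  induction n with
  | zero => simpa using hN x hx
  | succ n ih =>
    rw [iterate_succ_apply']
    exact lt_trans ih (hN _ (iterate_mem_of_mapsTo hS hx (n + 1)))

/-- **No-escape lemma.** A point of a forward-invariant set on which some potential strictly
increases under `f` is not preperiodic: the potential would have to return to its initial
value along the eventual cycle. This is the common mechanism behind the local escape
estimates (Looper 2021, Lemma 8.1 = Ingram's bound, at every place of `ℚ`). [folklore] -/
theorem not_isPreperiodicPt_of_increasing {α β : Type*} [Preorder β] {f : α → α} {S : Set α}
    (hS : ∀ z ∈ S, f z ∈ S) (N : α → β) (hN : ∀ z ∈ S, N z < N (f z)) {x : α} (hx : x ∈ S) :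
    ¬ IsPreperiodicPt f x := by
  rintro ⟨n, hn⟩
  obtain ⟨k, hk, hkx⟩ := mem_periodicPts.1 hn
  have hw : f^[n] x ∈ S := iterate_mem_of_mapsTo hS hx n
  obtain ⟨k', rfl⟩ := Nat.exists_eq_succ_of_ne_zero hk.ne'
  have h1 := lt_iterate_succ_of_increasing hS N hN hw k'
  rw [hkx.eq] at h1
  exact lt_irrefl _ h1

/-! ### The archimedean box (Lemma 8.1 at `v = ∞`) -/

/-- Archimedean escape step for `z ↦ z ^ d + c` on `ℚ`: if `|z| ^ d > 2|c|` and `|z| ^ (d-1) >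
2` then `|z ^ d + c| > |z|` (indeed `|z^d + c| ≥ |z|^d − |c| > |z|^d / 2 = |z| · |z|^{d−1} /
2 > |z|`). [folklore] -/
theorem abs_lt_abs_unicritical {d : ℕ} (hd : 2 ≤ d) {c z : ℚ}
    (h1 : 2 * |c| < |z| ^ d) (h2 : 2 < |z| ^ (d - 1)) : |z| < |unicritical d c z| := by
  rw [unicritical_apply]
  have hz0 : 0 < |z| := by
    rcases (abs_nonneg z).eq_or_lt with h | h
    · rw [← h, zero_pow (by omega)] at h2; norm_num at h2
    · exact h
  have hzd : |z| ^ d = |z| * |z| ^ (d - 1) := by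
    rw [← pow_succ']; congr 1; omega
  have htri : |z| ^ d - |c| ≤ |z ^ d + c| := by
    have := abs_add_le (z ^ d + c) (-c)
    rw [abs_neg, add_neg_cancel_right, abs_pow] at this
    linarith
  have hc : 0 ≤ |c| := abs_nonneg c
  nlinarith

/-- **Archimedean box** — Looper 2021, Lemma 8.1 (Ingram: `λ̂_v(α) = 0 ⟹ α ∈ D(0, 2_v
|c|_v^{1/d})`) at the place `v = ∞` of `ℚ`, in the crude but sufficient form: a rational
preperiodic point of `z ^ d + c` satisfies `|z| ^ d ≤ 2|c|` or `|z| ^ (d-1) ≤ 2` (otherwise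
`|·|` strictly increases along the orbit, `abs_lt_abs_unicritical`, contradicting the no-
escape lemma). [cite: Looper2021, Lemma 8.1] -/
theorem abs_pow_le_or_of_mem_ratPreperiodicPts {d : ℕ} (hd : 2 ≤ d) {c z : ℚ}
    (hz : z ∈ ratPreperiodicPts d c) : |z| ^ d ≤ 2 * |c| ∨ |z| ^ (d - 1) ≤ 2 := by
  by_contra h
  push Not at h
  refine not_isPreperiodicPt_of_increasing (f := unicritical d c)
    (S := {w : ℚ | 2 * |c| < |w| ^ d ∧ 2 < |w| ^ (d - 1)}) ?_ (fun w => |w|) ?_ h hz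
  · rintro w ⟨hw1, hw2⟩
    have hlt := abs_lt_abs_unicritical hd hw1 hw2
    have hw0 : 0 ≤ |w| := abs_nonneg w
    refine ⟨lt_trans hw1 ?_, lt_trans hw2 ?_⟩
    · exact pow_lt_pow_left₀ hlt hw0 (by omega)
    · exact pow_lt_pow_left₀ hlt hw0 (by omega)
  · rintro w ⟨hw1, hw2⟩
    exact abs_lt_abs_unicritical hd hw1 hw2

/-- Archimedean box, second form: a rational preperiodic point of `z ^ d + c` (`d ≥ 2`) has `|z|
^ d ≤ 2|c|` or `|z| ≤ 2`. [cite: Looper2021, Lemma 8.1] -/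
theorem abs_pow_le_or_abs_le_of_mem_ratPreperiodicPts {d : ℕ} (hd : 2 ≤ d) {c z : ℚ}
    (hz : z ∈ ratPreperiodicPts d c) : |z| ^ d ≤ 2 * |c| ∨ |z| ≤ 2 := by
  rcases abs_pow_le_or_of_mem_ratPreperiodicPts hd hz with h | h
  · exact Or.inl h
  · right
    by_contra h2
    push Not at h2
    have : (2 : ℚ) ^ (d - 1) < |z| ^ (d - 1) := pow_lt_pow_left₀ h2 (by norm_num) (by omega)
    have h22 : (2 : ℚ) ≤ 2 ^ (d - 1) := by
      calc (2 : ℚ) = 2 ^ 1 := by norm_num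
        _ ≤ 2 ^ (d - 1) := pow_le_pow_right₀ (by norm_num) (by omega)
    linarith

/-! ### The `p`-adic box (Lemma 8.1 at finite places) -/

/-- `p`-adic escape step: if `‖c‖_p < ‖z‖_p ^ d` then `‖z ^ d + c‖_p = ‖z‖_p ^ d` (ultrametric
maximum principle). [folklore] -/
theorem padicNorm_unicritical_eq {p : ℕ} [Fact p.Prime] {d : ℕ} {c z : ℚ}
    (h2 : padicNorm p c < padicNorm p z ^ d) :
    padicNorm p (unicritical d c z) = padicNorm p z ^ d := by
  rw [unicritical_apply]
  have hpow : padicNorm p (z ^ d) = padicNorm p z ^ d := IsAbsoluteValue.abv_pow (padicNorm p) z d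
  rw [padicNorm.add_eq_max_of_ne (by rw [hpow]; exact h2.ne'), hpow, max_eq_left h2.le]

/-- **`p`-adic box** — Looper 2021, Lemma 8.1 at a finite place `p` of `ℚ`: a rational
preperiodic point of `z ^ d + c` cannot satisfy both `‖z‖_p > 1` and `‖z‖_p ^ d > ‖c‖_p`
(else `‖·‖_p` strictly increases along the orbit). [cite: Looper2021, Lemma 8.1] -/
theorem not_padic_escape_of_mem_ratPreperiodicPts {p : ℕ} [Fact p.Prime] {d : ℕ} (hd : 2 ≤ d)
    {c z : ℚ} (hz : z ∈ ratPreperiodicPts d c) :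
    ¬ (1 < padicNorm p z ∧ padicNorm p c < padicNorm p z ^ d) := by
  intro h
  refine not_isPreperiodicPt_of_increasing (f := unicritical d c)
    (S := {w : ℚ | 1 < padicNorm p w ∧ padicNorm p c < padicNorm p w ^ d}) ?_
    (fun w => padicNorm p w) ?_ h hz
  · rintro w ⟨hw1, hw2⟩
    have heq := padicNorm_unicritical_eq (d := d) (c := c) hw2
    have hlt : padicNorm p w < padicNorm p w ^ d := by
      calc padicNorm p w = padicNorm p w ^ 1 := (pow_one _).symm
        _ < padicNorm p w ^ d := pow_lt_pow_right₀ hw1 (by omega)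
    refine ⟨?_, ?_⟩
    · show 1 < padicNorm p (unicritical d c w)
      rw [heq]; exact lt_trans hw1 hlt
    · show padicNorm p c < padicNorm p (unicritical d c w) ^ d
      rw [heq]
      exact lt_trans hw2 (pow_lt_pow_left₀ hlt (padicNorm.nonneg _) (by omega))
  · rintro w ⟨hw1, hw2⟩
    show padicNorm p w < padicNorm p (unicritical d c w)
    rw [padicNorm_unicritical_eq hw2]
    calc padicNorm p w = padicNorm p w ^ 1 := (pow_one _).symm
      _ < padicNorm p w ^ d := pow_lt_pow_right₀ hw1 (by omega)

/-- At a prime `p` of the denominator of `c` (`‖c‖_p > 1`) every rational preperiodic point of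
`z ^ d + c` has `‖z‖_p ^ d = ‖c‖_p` *exactly*: if `‖z‖_p^d < ‖c‖_p` then `‖f(z)‖_p = ‖c‖_p >
1` and `f(z)` escapes, if `‖z‖_p^d > ‖c‖_p` then `z` escapes. This is the relation `v_𝔭(p_i)
= v_𝔭(c)/d` for `v_𝔭(c) < 0` used on p. 21 of the source. [cite: Looper2021, §8 (proof of
Thm. 1.2, d ≥ 5)] -/
theorem padicNorm_pow_eq_of_mem_ratPreperiodicPts {p : ℕ} [Fact p.Prime] {d : ℕ} (hd : 2 ≤ d)
    {c z : ℚ} (hc : 1 < padicNorm p c) (hz : z ∈ ratPreperiodicPts d c) :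
    padicNorm p z ^ d = padicNorm p c := by
  rcases lt_trichotomy (padicNorm p z ^ d) (padicNorm p c) with h | h | h
  · exfalso
    have hfz : unicritical d c z ∈ ratPreperiodicPts d c := IsPreperiodicPt.apply hz
    have hpow : padicNorm p (z ^ d) = padicNorm p z ^ d := IsAbsoluteValue.abv_pow (padicNorm p) z d
    have heq : padicNorm p (unicritical d c z) = padicNorm p c := by
      rw [unicritical_apply, padicNorm.add_eq_max_of_ne (by rw [hpow]; exact h.ne), hpow,
        max_eq_right h.le]
    apply not_padic_escape_of_mem_ratPreperiodicPts (p := p) hd hfz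
    rw [heq]
    refine ⟨hc, ?_⟩
    calc padicNorm p c = padicNorm p c ^ 1 := (pow_one _).symm
      _ < padicNorm p c ^ d := pow_lt_pow_right₀ hc (by omega)
  · exact h
  · exfalso
    apply not_padic_escape_of_mem_ratPreperiodicPts (p := p) hd hz
    refine ⟨?_, h⟩
    by_contra hle
    push Not at hle
    have : padicNorm p z ^ d ≤ 1 := pow_le_one₀ (padicNorm.nonneg _) hle
    linarith

/-! ### Denominators of rational preperiodic points -/

/-- If the prime `p` does not divide the denominator of `q ∈ ℚ` then `‖q‖_p ≤ 1`. [folklore] -/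
theorem padicNorm_le_one_of_not_dvd_den {p : ℕ} [Fact p.Prime] {q : ℚ} (h : ¬ p ∣ q.den) :
    padicNorm p q ≤ 1 := by
  conv_lhs => rw [← Rat.num_div_den q]
  rw [padicNorm.div, (padicNorm.nat_eq_one_iff q.den).2 h, div_one]
  exact padicNorm.of_int _

/-- If the prime `p` divides the denominator of `q ∈ ℚ` then `‖q‖_p = p ^ {v_p(den q)}` (the
numerator is then prime to `p`). [folklore] -/
theorem padicNorm_eq_pow_of_dvd_den {p : ℕ} [hp : Fact p.Prime] {q : ℚ} (h : p ∣ q.den) :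
    padicNorm p q = (p : ℚ) ^ padicValNat p q.den := by
  have hnum : ¬ (p : ℤ) ∣ q.num := by
    intro hdvd
    have h1 : p ∣ q.num.natAbs := Int.natCast_dvd.1 hdvd
    have := Nat.eq_one_of_dvd_coprimes q.reduced h1 h
    exact hp.out.one_lt.ne' this
  conv_lhs => rw [← Rat.num_div_den q]
  have hden0 : ((q.den : ℕ) : ℚ) ≠ 0 := Nat.cast_ne_zero.2 q.den_nz
  rw [padicNorm.div, (padicNorm.int_eq_one_iff q.num).2 hnum, one_div,
    padicNorm.eq_zpow_of_nonzero hden0, padicValRat.of_nat, zpow_neg, inv_inv, zpow_natCast]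

/-- If the prime `p` divides the denominator of `q ∈ ℚ` then `‖q‖_p > 1`. [folklore] -/
theorem one_lt_padicNorm_of_dvd_den {p : ℕ} [hp : Fact p.Prime] {q : ℚ} (h : p ∣ q.den) :
    1 < padicNorm p q := by
  rw [padicNorm_eq_pow_of_dvd_den h]
  have hv : 1 ≤ padicValNat p q.den := one_le_padicValNat_of_dvd q.den_nz h
  exact one_lt_pow₀ (by exact_mod_cast hp.out.one_lt) (by omega)

/-- **Denominators of rational preperiodic points.** For every rational preperiodic point `z` of
`z ^ d + c` (`d ≥ 2`): `den(z) ^ d = den(c)`. (Compare prime by prime: at `p ∤ den c` the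
`p`-adic box gives `‖z‖_p ≤ 1`; at `p ∣ den c` the exact relation `‖z‖_p^d = ‖c‖_p` gives `d
· v_p(den z) = v_p(den c)`.) In particular rational preperiodic points exist only when
`den(c)` is a `d`-th power `e ^ d`, and then they are exactly of the form `x / e` with `x ∈
ℤ` prime to `e` — the global content of `v_𝔭(p_i) = v_𝔭(c)/d` (source, p. 21). [cite:
Looper2021, §8 (proof of Thm. 1.2, d ≥ 5)] -/
theorem den_pow_eq_den_of_mem_ratPreperiodicPts {d : ℕ} (hd : 2 ≤ d) {c z : ℚ}
    (hz : z ∈ ratPreperiodicPts d c) : z.den ^ d = c.den := by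
  apply (Nat.eq_iff_prime_padicValNat_eq _ _ (pow_ne_zero _ z.den_nz) c.den_nz).2
  intro p hp
  haveI := Fact.mk hp
  rw [padicValNat.pow]
  by_cases hpc : p ∣ c.den
  · have hc1 : 1 < padicNorm p c := one_lt_padicNorm_of_dvd_den hpc
    have heq := padicNorm_pow_eq_of_mem_ratPreperiodicPts (p := p) hd hc1 hz
    have hpz : p ∣ z.den := by
      by_contra hnd
      have h1 := padicNorm_le_one_of_not_dvd_den (p := p) hnd
      have : padicNorm p z ^ d ≤ 1 := pow_le_one₀ (padicNorm.nonneg _) h1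
      linarith
    rw [padicNorm_eq_pow_of_dvd_den hpz, padicNorm_eq_pow_of_dvd_den hpc, ← pow_mul] at heq
    have heq' : p ^ (padicValNat p z.den * d) = p ^ padicValNat p c.den := by exact_mod_cast heq
    have := Nat.pow_right_injective hp.two_le heq'
    rw [← this, Nat.mul_comm]
  · have hc1 : padicNorm p c ≤ 1 := padicNorm_le_one_of_not_dvd_den hpc
    have hpz : ¬ p ∣ z.den := by
      intro hdvd
      have hz1 : 1 < padicNorm p z := one_lt_padicNorm_of_dvd_den hdvd
      apply not_padic_escape_of_mem_ratPreperiodicPts (p := p) hd hz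
      exact ⟨hz1, lt_of_le_of_lt hc1 (one_lt_pow₀ hz1 (by omega))⟩
    rw [padicValNat.eq_zero_of_not_dvd hpz, padicValNat.eq_zero_of_not_dvd hpc, Nat.mul_zero]

/-- All rational preperiodic points of `z ^ d + c` (`d ≥ 2`) have the same denominator. [cite:
Looper2021, §8 (proof of Thm. 1.2, d ≥ 5)] -/
theorem den_eq_den_of_mem_ratPreperiodicPts {d : ℕ} (hd : 2 ≤ d) {c z w : ℚ}
    (hz : z ∈ ratPreperiodicPts d c) (hw : w ∈ ratPreperiodicPts d c) : z.den = w.den :=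
  Nat.pow_left_injective (by omega : d ≠ 0)
    (by simp only [den_pow_eq_den_of_mem_ratPreperiodicPts hd hz,
      den_pow_eq_den_of_mem_ratPreperiodicPts hd hw])

/-! ### Counting in a box; numerator heights (Lemma 8.2) -/

/-- **Counting in a box** (the role played by Northcott's theorem on p. 21 of the source): if
all rational preperiodic points of `z ^ d + c` have denominator `e` and absolute value `≤
T`, there are at most `2⌊T e⌋ + 1` of them (their numerators are distinct integers in `[-Te,
Te]`). [folklore] -/
theorem encard_ratPreperiodicPts_le_of_abs_le {d : ℕ} {c : ℚ} {e : ℕ} {T : ℚ}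
    (hden : ∀ z ∈ ratPreperiodicPts d c, z.den = e) (hb : ∀ z ∈ ratPreperiodicPts d c, |z| ≤ T) :
    (ratPreperiodicPts d c).encard ≤ (2 * ⌊T * e⌋₊ + 1 : ℕ) := by
  set K : ℕ := ⌊T * e⌋₊ with hK
  have hmaps : MapsTo Rat.num (ratPreperiodicPts d c) (↑(Finset.Icc (-(K : ℤ)) K) : Set ℤ) := by
    intro z hz
    rw [Finset.coe_Icc]
    simp only [mem_Icc]
    have h1 : |(z.num : ℚ)| ≤ T * e := by
      rw [← Rat.mul_den_eq_num z, hden z hz, abs_mul, Nat.abs_cast]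
      exact mul_le_mul_of_nonneg_right (hb z hz) (Nat.cast_nonneg _)
    have h2 : z.num.natAbs ≤ K := by
      apply Nat.le_floor
      have : ((z.num.natAbs : ℕ) : ℚ) = |(z.num : ℚ)| := by simp [Nat.cast_natAbs, Int.cast_abs]
      rw [this]; exact h1
    omega
  have hinj : InjOn Rat.num (ratPreperiodicPts d c) := by
    intro z hz w hw h
    exact Rat.ext h ((hden z hz).trans (hden w hw).symm)
  calc (ratPreperiodicPts d c).encard ≤ (↑(Finset.Icc (-(K : ℤ)) K) : Set ℤ).encard :=
        encard_le_encard_of_injOn hmaps hinj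
    _ = ((Finset.Icc (-(K : ℤ)) K).card : ℕ∞) := encard_coe_eq_coe_finsetCard _
    _ = ((2 * K + 1 : ℕ) : ℕ∞) := by
        rw [Int.card_Icc]; congr 1; omega

/-- Archimedean box for numerators: for a rational preperiodic point `z = x/e` of `z ^ d + c`
with `c = a / e^d`, either `|x| ^ d ≤ 2|a|` or `|x| ≤ 2e` — the height bound `h(p_i) ≤
h(c)/d + log 2` of Looper 2021, Lemma 8.2 (proof), over `ℚ`. [cite: Looper2021, Lemma 8.2] -/
theorem natAbs_num_pow_le_or_of_mem_ratPreperiodicPts {d : ℕ} (hd : 2 ≤ d) {c z : ℚ}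
    (hz : z ∈ ratPreperiodicPts d c) :
    z.num.natAbs ^ d ≤ 2 * c.num.natAbs ∨ z.num.natAbs ≤ 2 * z.den := by
  have hx : ((z.num.natAbs : ℕ) : ℚ) = |z| * z.den := by
    rw [Nat.cast_natAbs, Int.cast_abs, ← Rat.mul_den_eq_num, abs_mul, Nat.abs_cast]
  have hcn : ((c.num.natAbs : ℕ) : ℚ) = |c| * c.den := by
    rw [Nat.cast_natAbs, Int.cast_abs, ← Rat.mul_den_eq_num, abs_mul, Nat.abs_cast]
  have hdend := den_pow_eq_den_of_mem_ratPreperiodicPts hd hz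
  rcases abs_pow_le_or_abs_le_of_mem_ratPreperiodicPts hd hz with h | h
  · left
    have h' : (|z| * z.den) ^ d ≤ 2 * (|c| * c.den) := by
      rw [mul_pow, ← hdend, Nat.cast_pow, ← mul_assoc]
      exact mul_le_mul_of_nonneg_right h (by positivity)
    rw [← hx, ← hcn] at h'
    exact_mod_cast h'
  · right
    have h' : |z| * z.den ≤ 2 * z.den := mul_le_mul_of_nonneg_right h (by positivity)
    rw [← hx] at h'
    exact_mod_cast h'

/-! ### The easier case: a dominant archimedean place (§4, Prop. 4.1 with `S = {∞}`) -/

/-- Expansion of `u ↦ u ^ d` away from `0`: for `0 < m ≤ u, v`, `m ^ (d-1) · |u − v| ≤ |u ^ d −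
v ^ d|` (from `u^d − v^d = (u − v) Σ u^i v^{d−1−i}` and the `i = 0` term). [folklore] -/
theorem pow_sub_pow_expand_pos {d : ℕ} (hd : 1 ≤ d) {u v m : ℝ} (hm : 0 < m) (hu : m ≤ u)
    (hv : m ≤ v) : m ^ (d - 1) * |u - v| ≤ |u ^ d - v ^ d| := by
  have hgeom := geom_sum₂_mul u v d
  have hu0 : 0 ≤ u := le_trans hm.le hu
  have hv0 : 0 ≤ v := le_trans hm.le hv
  have hS0 : 0 ≤ ∑ i ∈ Finset.range d, u ^ i * v ^ (d - 1 - i) :=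
    Finset.sum_nonneg (fun i _ => by positivity)
  have hSm : m ^ (d - 1) ≤ ∑ i ∈ Finset.range d, u ^ i * v ^ (d - 1 - i) := by
    calc m ^ (d - 1) ≤ v ^ (d - 1) := pow_le_pow_left₀ hm.le hv _
      _ = u ^ 0 * v ^ (d - 1 - 0) := by simp
      _ ≤ ∑ i ∈ Finset.range d, u ^ i * v ^ (d - 1 - i) :=
          Finset.single_le_sum (f := fun i => u ^ i * v ^ (d - 1 - i))
            (fun i _ => by positivity) (Finset.mem_range.2 (by omega))
  rw [← hgeom, abs_mul, abs_of_nonneg hS0]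
  exact mul_le_mul_of_nonneg_right hSm (abs_nonneg _)

/-- Expansion of `u ↦ u ^ d` on a sign cluster: for real `u, v` of the same sign with `|u|, |v|
≥ m > 0`, `m ^ (d-1) · |u − v| ≤ |u ^ d − v ^ d|`. [folklore] -/
theorem pow_sub_pow_expand {d : ℕ} (hd : 1 ≤ d) {u v m : ℝ} (hm : 0 < m) (hu : m ≤ |u|)
    (hv : m ≤ |v|) (huv : 0 < u * v) : m ^ (d - 1) * |u - v| ≤ |u ^ d - v ^ d| := by
  rcases lt_or_gt_of_ne (show u ≠ 0 from fun h => by rw [h, zero_mul] at huv; exact lt_irrefl _ huv)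
    with hu0 | hu0
  · have hv0 : v < 0 := by
      by_contra h; push Not at h
      have : u * v ≤ 0 := mul_nonpos_of_nonpos_of_nonneg hu0.le h
      linarith
    rw [abs_of_neg hu0] at hu
    rw [abs_of_neg hv0] at hv
    have h := pow_sub_pow_expand_pos hd hm hu hv
    have h1 : |(-u) - (-v)| = |u - v| := by
      rw [show (-u) - (-v) = -(u - v) by ring, abs_neg]
    have h2 : |(-u) ^ d - (-v) ^ d| = |u ^ d - v ^ d| := by
      rw [neg_pow, neg_pow v, ← mul_sub, abs_mul, abs_pow, abs_neg, abs_one, one_pow, one_mul]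
    rwa [h1, h2] at h
  · have hv0 : 0 < v := pos_of_mul_pos_right huv hu0.le
    rw [abs_of_pos hu0] at hu
    rw [abs_of_pos hv0] at hv
    exact pow_sub_pow_expand_pos hd hm hu hv

/-- (B1) For `|c| ≥ 2^{d+3}` every rational preperiodic point of `z ^ d + c` has `|z| ≤ R :=
(2|c|)^{1/d}` (archimedean box; `R ≥ 2` absorbs the alternative `|z| ≤ 2`). Here and below
`R` is any real with `R ≥ 0`, `R ^ d = 2|c|`. [cite: Looper2021, Lemma 8.1] -/
theorem abs_le_R_of_mem_ratPreperiodicPts {d : ℕ} (hd : 2 ≤ d) {c : ℚ} {R : ℝ} (hR0 : 0 ≤ R)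
    (hRd : R ^ d = 2 * |(c : ℝ)|) (hc : (2 : ℚ) ^ (d + 3) ≤ |c|) {z : ℚ}
    (hz : z ∈ ratPreperiodicPts d c) : |(z : ℝ)| ≤ R := by
  have hd0 : d ≠ 0 := by omega
  have hR2 : 2 ≤ R := by
    have h2d : (2 : ℝ) ^ d ≤ R ^ d := by
      rw [hRd]
      have hc' : (2 : ℝ) ^ (d + 3) ≤ |(c : ℝ)| := by
        rw [← Rat.cast_abs]; exact_mod_cast hc
      calc (2 : ℝ) ^ d ≤ 2 ^ (d + 3) := pow_le_pow_right₀ (by norm_num) (by omega)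
        _ ≤ |(c : ℝ)| := hc'
        _ ≤ 2 * |(c : ℝ)| := by linarith [abs_nonneg (c : ℝ)]
    exact (pow_le_pow_iff_left₀ (by norm_num) hR0 hd0).1 h2d
  rcases abs_pow_le_or_abs_le_of_mem_ratPreperiodicPts hd hz with h | h
  · have h' : |(z : ℝ)| ^ d ≤ R ^ d := by
      rw [hRd, ← Rat.cast_abs]; exact_mod_cast h
    exact (pow_le_pow_iff_left₀ (abs_nonneg _) hR0 hd0).1 h'
  · have h' : |(z : ℝ)| ≤ 2 := by rw [← Rat.cast_abs]; exact_mod_cast h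
    linarith

/-- For `|c| ≥ 2^{d+3}` and `R ^ d = 2|c|`, `R ≥ 0`: `R ≤ |c|/2`. [folklore] -/
theorem R_le_half_abs {d : ℕ} (hd : 2 ≤ d) {c : ℚ} {R : ℝ} (hR0 : 0 ≤ R)
    (hRd : R ^ d = 2 * |(c : ℝ)|) (hc : (2 : ℚ) ^ (d + 3) ≤ |c|) : R ≤ |(c : ℝ)| / 2 := by
  have hd0 : d ≠ 0 := by omega
  have hc' : (2 : ℝ) ^ (d + 3) ≤ |(c : ℝ)| := by
    rw [← Rat.cast_abs]; exact_mod_cast hc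
  have h8 : (8 : ℝ) ≤ |(c : ℝ)| := by
    calc (8 : ℝ) = 2 ^ 3 := by norm_num
      _ ≤ 2 ^ (d + 3) := pow_le_pow_right₀ (by norm_num) (by omega)
      _ ≤ |(c : ℝ)| := hc'
  have hpow : R ^ d ≤ (|(c : ℝ)| / 2) ^ d := by
    rw [hRd]
    calc 2 * |(c : ℝ)| ≤ (|(c : ℝ)| / 2) ^ 2 := by nlinarith
      _ ≤ (|(c : ℝ)| / 2) ^ d := pow_le_pow_right₀ (by linarith) hd
  exact (pow_le_pow_iff_left₀ hR0 (by positivity) hd0).1 hpow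

/-- (B2) For `|c| ≥ 2^{d+3}` every rational preperiodic point of `z ^ d + c` has `|z| ^ d ≥
|c|/2`: its image `z^d + c` is again preperiodic, so `|z^d + c| ≤ R ≤ |c|/2`. This is the
archimedean lower bound `λ_v(p_i) ≥ λ_v(c)/d − C` (Ingram) invoked in the proof of Looper
2021, Prop. 8.4, (archPilb). [cite: Looper2021, Prop. 8.4 (proof, inequality (archPilb))] -/
theorem half_abs_le_pow_of_mem_ratPreperiodicPts {d : ℕ} (hd : 2 ≤ d) {c : ℚ} {R : ℝ}
    (hR0 : 0 ≤ R) (hRd : R ^ d = 2 * |(c : ℝ)|) (hc : (2 : ℚ) ^ (d + 3) ≤ |c|) {z : ℚ}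
    (hz : z ∈ ratPreperiodicPts d c) : |(c : ℝ)| / 2 ≤ |(z : ℝ)| ^ d := by
  have hfz : unicritical d c z ∈ ratPreperiodicPts d c := IsPreperiodicPt.apply hz
  have h1 := abs_le_R_of_mem_ratPreperiodicPts hd hR0 hRd hc hfz
  rw [unicritical_apply, Rat.cast_add, Rat.cast_pow] at h1
  have h2 := R_le_half_abs hd hR0 hRd hc
  have htri : |(c : ℝ)| - |(z : ℝ) ^ d + c| ≤ |(z : ℝ) ^ d| := by
    have := abs_add_le ((z : ℝ) ^ d + c) (-(z : ℝ) ^ d)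
    rw [abs_neg, show (z : ℝ) ^ d + c + -(z : ℝ) ^ d = c by ring] at this
    linarith
  rw [abs_pow] at htri
  linarith

/-- For `|c| ≥ 2^{d+3}`, `0` is not a rational preperiodic point of `z ^ d + c`. [cite:
Looper2021, Prop. 8.4 (proof, inequality (archPilb))] -/
theorem ne_zero_of_mem_ratPreperiodicPts_of_large {d : ℕ} (hd : 2 ≤ d) {c : ℚ}
    (hc : (2 : ℚ) ^ (d + 3) ≤ |c|) {z : ℚ} (hz : z ∈ ratPreperiodicPts d c) : z ≠ 0 := by
  intro h0
  set R : ℝ := (2 * |(c : ℝ)|) ^ ((d : ℝ)⁻¹) with hR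
  have hR0 : 0 ≤ R := Real.rpow_nonneg (by positivity) _
  have hRd : R ^ d = 2 * |(c : ℝ)| := Real.rpow_inv_natCast_pow (by positivity) (by omega)
  have h := half_abs_le_pow_of_mem_ratPreperiodicPts hd hR0 hRd hc hz
  rw [h0, Rat.cast_zero, abs_zero, zero_pow (by omega)] at h
  have hc' : (2 : ℝ) ^ (d + 3) ≤ |(c : ℝ)| := by
    rw [← Rat.cast_abs]; exact_mod_cast hc
  have : (0 : ℝ) < 2 ^ (d + 3) := by positivity
  linarith

/-- (B3) **One expansion step.** For `|c| ≥ 2^{d+3}`, two rational preperiodic points `z, w` of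
`f = z ^ d + c` of the same sign satisfy `Λ · |z − w| ≤ |f z − f w|` with `Λ = |c| / (2R)`,
`R = (2|c|)^{1/d}`: by (B1), (B2) the smaller modulus `m` has `m^{d−1} = m^d/m ≥ (|c|/2)/R`.
This elementary real-dynamics statement (uniform expansion of `f` on the real trace of its
filled Julia set at a dominant archimedean place) replaces, for `K = ℚ`, `S = {∞}`, the
potential-theoretic input (Prop. 4.2, transfinite diameters) of Looper 2021, §4. [cite:
Looper2021, §4 (Prop. 4.1, Prop. 4.2)] -/
theorem expand_step_of_mem_ratPreperiodicPts {d : ℕ} (hd : 2 ≤ d) {c : ℚ} {R : ℝ} (hR0 : 0 < R)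
    (hRd : R ^ d = 2 * |(c : ℝ)|) (hc : (2 : ℚ) ^ (d + 3) ≤ |c|) {z w : ℚ}
    (hz : z ∈ ratPreperiodicPts d c) (hw : w ∈ ratPreperiodicPts d c) (hzw : 0 < z * w) :
    |(c : ℝ)| / (2 * R) * |(z : ℝ) - w| ≤
      |(unicritical d c z : ℝ) - (unicritical d c w : ℝ)| := by
  have hzR := abs_le_R_of_mem_ratPreperiodicPts hd hR0.le hRd hc hz
  have hwR := abs_le_R_of_mem_ratPreperiodicPts hd hR0.le hRd hc hw
  have hzd := half_abs_le_pow_of_mem_ratPreperiodicPts hd hR0.le hRd hc hz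
  have hwd := half_abs_le_pow_of_mem_ratPreperiodicPts hd hR0.le hRd hc hw
  set m : ℝ := min |(z : ℝ)| |(w : ℝ)| with hm
  have hc8 : (8 : ℝ) ≤ |(c : ℝ)| := by
    have hc' : (2 : ℝ) ^ (d + 3) ≤ |(c : ℝ)| := by
      rw [← Rat.cast_abs]; exact_mod_cast hc
    calc (8 : ℝ) = 2 ^ 3 := by norm_num
      _ ≤ 2 ^ (d + 3) := pow_le_pow_right₀ (by norm_num) (by omega)
      _ ≤ |(c : ℝ)| := hc'
  have hmd : |(c : ℝ)| / 2 ≤ m ^ d := by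
    rcases min_choice |(z : ℝ)| |(w : ℝ)| with h | h <;> rw [hm, h]
    · exact hzd
    · exact hwd
  have hmR : m ≤ R := le_trans (min_le_left _ _) hzR
  have hm0 : 0 < m := by
    rcases (le_min (abs_nonneg (z : ℝ)) (abs_nonneg (w : ℝ))).eq_or_lt with h | h
    · rw [← hm] at h
      rw [← h, zero_pow (by omega)] at hmd
      linarith
    · rwa [← hm] at h
  -- m^(d-1) ≥ |c|/(2R)
  have hmd1 : |(c : ℝ)| / (2 * R) ≤ m ^ (d - 1) := by
    have hsplit : m ^ d = m * m ^ (d - 1) := by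
      rw [← pow_succ']; congr 1; omega
    rw [div_le_iff₀ (by positivity)]
    calc |(c : ℝ)| = 2 * (|(c : ℝ)| / 2) := by ring
      _ ≤ 2 * (m * m ^ (d - 1)) := by rw [← hsplit]; linarith
      _ ≤ 2 * (R * m ^ (d - 1)) := by
          have : 0 ≤ m ^ (d - 1) := by positivity
          nlinarith
      _ = m ^ (d - 1) * (2 * R) := by ring
  have huv : 0 < (z : ℝ) * (w : ℝ) := by exact_mod_cast hzw
  have key := pow_sub_pow_expand (d := d) (by omega) hm0 (min_le_left _ _) (min_le_right _ _) huv
  have hf : (unicritical d c z : ℝ) - (unicritical d c w : ℝ) = (z : ℝ) ^ d - (w : ℝ) ^ d := by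
    simp only [unicritical_apply, Rat.cast_add, Rat.cast_pow]; ring
  rw [hf]
  calc |(c : ℝ)| / (2 * R) * |(z : ℝ) - w| ≤ m ^ (d - 1) * |(z : ℝ) - w| :=
        mul_le_mul_of_nonneg_right hmd1 (abs_nonneg _)
    _ ≤ |(z : ℝ) ^ d - (w : ℝ) ^ d| := key

/-- Numerical endgame of the easier case: with `R ^ d = 2C`, `C ≥ 2^{d+3}`, `0 < e < C` and `d ≥
5`, the inequality `(C/(2R))^3 ≤ 2Re` is impossible (it forces `C^{2d−4} < 2^{4d+4} ≤
16^{2d−4} ≤ C^{2d−4}`). [folklore] -/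
theorem caseB_numeric {d : ℕ} (hd : 5 ≤ d) {C R e : ℝ} (hR : 0 < R) (hRd : R ^ d = 2 * C)
    (hC : (2 : ℝ) ^ (d + 3) ≤ C) (he1 : 0 < e) (heC : e < C)
    (h : (C / (2 * R)) ^ 3 ≤ 2 * R * e) : False := by
  have hC0 : 0 < C := lt_trans he1 heC
  have h1 : C ^ 3 ≤ 16 * R ^ 4 * e := by
    have h' : (C / (2 * R)) ^ 3 = C ^ 3 / (8 * R ^ 3) := by rw [div_pow]; ring
    rw [h', div_le_iff₀ (by positivity)] at h
    calc C ^ 3 ≤ 2 * R * e * (8 * R ^ 3) := h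
      _ = 16 * R ^ 4 * e := by ring
  have h2 : (C ^ 3) ^ d ≤ (16 * R ^ 4 * e) ^ d := pow_le_pow_left₀ (by positivity) h1 d
  have h3 : (16 * R ^ 4 * e) ^ d = 16 ^ d * (2 * C) ^ 4 * e ^ d := by
    rw [mul_pow, mul_pow, ← pow_mul, mul_comm 4 d, pow_mul, hRd]
  have h4 : e ^ d < C ^ d := pow_lt_pow_left₀ heC he1.le (by omega)
  have h5 : (C ^ 3) ^ d < 16 ^ d * (2 * C) ^ 4 * C ^ d := by
    calc (C ^ 3) ^ d ≤ 16 ^ d * (2 * C) ^ 4 * e ^ d := h3 ▸ h2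
      _ < 16 ^ d * (2 * C) ^ 4 * C ^ d := by gcongr
  have h6 : (C ^ 3) ^ d = C ^ (2 * d - 4) * C ^ (d + 4) := by
    rw [← pow_mul, ← pow_add]; congr 1; omega
  have h7 : (16 : ℝ) ^ d * (2 * C) ^ 4 * C ^ d = (16 : ℝ) ^ (d + 1) * C ^ (d + 4) := by
    rw [mul_pow, pow_succ, pow_add]; norm_num; ring
  rw [h6, h7] at h5
  have h8 : C ^ (2 * d - 4) < (16 : ℝ) ^ (d + 1) := lt_of_mul_lt_mul_right h5 (by positivity)
  have h16 : (16 : ℝ) ≤ C := by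
    calc (16 : ℝ) = 2 ^ 4 := by norm_num
      _ ≤ 2 ^ (d + 3) := pow_le_pow_right₀ (by norm_num) (by omega)
      _ ≤ C := hC
  have h9 : (16 : ℝ) ^ (2 * d - 4) ≤ C ^ (2 * d - 4) := pow_le_pow_left₀ (by norm_num) h16 _
  have h10 : (16 : ℝ) ^ (d + 1) ≤ 16 ^ (2 * d - 4) := pow_le_pow_right₀ (by norm_num) (by omega)
  linarith

/-- Two nonzero rationals with the same sign bit have positive product. [folklore] -/
theorem mul_pos_of_decide_eq {u v : ℚ} (hu : u ≠ 0) (hv : v ≠ 0)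
    (h : decide (0 < u) = decide (0 < v)) : 0 < u * v := by
  rw [decide_eq_decide] at h
  rcases lt_or_gt_of_ne hu with hu' | hu'
  · have hv' : v < 0 := by
      rcases lt_or_gt_of_ne hv with hv' | hv'
      · exact hv'
      · exact absurd (h.2 hv') (not_lt.2 hu'.le)
    exact mul_pos_of_neg_of_neg hu' hv'
  · exact mul_pos hu' (h.1 hu')

/-- **The easier case** — Looper 2021, Prop. 4.1 for `K = ℚ` and the single place `S = {∞}`,
with an explicit bound: if `d ≥ 5`, `|c| ≥ 2^{d+3}`, all rational preperiodic points of `f =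
z ^ d + c` have denominator `e` and `e < |c|` (i.e. the archimedean place carries a fixed
proportion of `h(c) = log max(|a|, e^d)`, `c = a/e^d`), then `f` has at most `8` rational
preperiodic points. Proof: the sign itinerary `z ↦ (sgn z, sgn f z, sgn f² z) ∈ {±}^3` is
injective on preperiodic points, since two distinct points with the same itinerary are `≥
1/e` apart (common denominator), are expanded by `Λ^3` in three steps (B3) and stay within
`[−R, R]`, giving `Λ^3 ≤ 2Re`, impossible by `caseB_numeric`. (The three steps mirror the
third iterate `f^{-3}` in Prop. 4.2 of the source; the published proof uses
equidistribution/transfinite diameter instead.) [cite: Looper2021, Prop. 4.1] -/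
theorem encard_ratPreperiodicPts_le_eight {d : ℕ} (hd : 5 ≤ d) {c : ℚ} {e : ℕ} (he : 0 < e)
    (hden : ∀ z ∈ ratPreperiodicPts d c, z.den = e) (hce : (e : ℚ) < |c|)
    (hc : (2 : ℚ) ^ (d + 3) ≤ |c|) : (ratPreperiodicPts d c).encard ≤ 8 := by
  have hd2 : 2 ≤ d := by omega
  set f := unicritical d c with hf
  set R : ℝ := (2 * |(c : ℝ)|) ^ ((d : ℝ)⁻¹) with hR
  have hc0 : (0 : ℝ) < |(c : ℝ)| := by
    have hc' : (2 : ℝ) ^ (d + 3) ≤ |(c : ℝ)| := by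
      rw [← Rat.cast_abs]; exact_mod_cast hc
    exact lt_of_lt_of_le (by positivity) hc'
  have hR0 : 0 < R := Real.rpow_pos_of_pos (by positivity) _
  have hRd : R ^ d = 2 * |(c : ℝ)| := Real.rpow_inv_natCast_pow (by positivity) (by omega)
  set Λ : ℝ := |(c : ℝ)| / (2 * R) with hΛ
  have hΛ0 : 0 < Λ := by positivity
  -- the itinerary map
  set ι : ℚ → Bool × Bool × Bool := fun z =>
    (decide (0 < z), decide (0 < f z), decide (0 < f (f z))) with hι
  have hmem_f : ∀ z ∈ ratPreperiodicPts d c, f z ∈ ratPreperiodicPts d c :=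
    fun z hz => IsPreperiodicPt.apply hz
  have hne0 : ∀ z ∈ ratPreperiodicPts d c, z ≠ 0 :=
    fun z hz => ne_zero_of_mem_ratPreperiodicPts_of_large hd2 hc hz
  have hstep : ∀ z ∈ ratPreperiodicPts d c, ∀ w ∈ ratPreperiodicPts d c,
      decide (0 < z) = decide (0 < w) → Λ * |(z : ℝ) - w| ≤ |(f z : ℝ) - (f w : ℝ)| := by
    intro z hz w hw hdec
    exact expand_step_of_mem_ratPreperiodicPts hd2 hR0 hRd hc hz hw
      (mul_pos_of_decide_eq (hne0 z hz) (hne0 w hw) hdec)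
  have hinj : InjOn ι (ratPreperiodicPts d c) := by
    intro z hz w hw hzw
    by_contra hne
    simp only [hι, Prod.mk.injEq] at hzw
    obtain ⟨h0, h1, h2⟩ := hzw
    have hz1 := hmem_f z hz
    have hw1 := hmem_f w hw
    have hz2 := hmem_f _ hz1
    have hw2 := hmem_f _ hw1
    have hz3 := hmem_f _ hz2
    have hw3 := hmem_f _ hw2
    have s0 := hstep z hz w hw h0
    have s1 := hstep _ hz1 _ hw1 h1
    have s2 := hstep _ hz2 _ hw2 h2
    -- chain
    have hchain : Λ ^ 3 * |(z : ℝ) - w| ≤ |(f (f (f z)) : ℝ) - (f (f (f w)) : ℝ)| := by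
      calc Λ ^ 3 * |(z : ℝ) - w| = Λ * (Λ * (Λ * |(z : ℝ) - w|)) := by ring
        _ ≤ Λ * (Λ * |(f z : ℝ) - f w|) := by gcongr
        _ ≤ Λ * |(f (f z) : ℝ) - f (f w)| := by gcongr
        _ ≤ |(f (f (f z)) : ℝ) - (f (f (f w)) : ℝ)| := s2
    -- upper bound by 2R
    have hup : |(f (f (f z)) : ℝ) - (f (f (f w)) : ℝ)| ≤ 2 * R := by
      have ha := abs_le_R_of_mem_ratPreperiodicPts hd2 hR0.le hRd hc hz3
      have hb := abs_le_R_of_mem_ratPreperiodicPts hd2 hR0.le hRd hc hw3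
      calc |(f (f (f z)) : ℝ) - (f (f (f w)) : ℝ)|
          ≤ |(f (f (f z)) : ℝ)| + |(f (f (f w)) : ℝ)| := abs_sub _ _
        _ ≤ 2 * R := by linarith
    -- separation: 1 ≤ e * |z - w|
    have hsep : (1 : ℝ) ≤ e * |(z : ℝ) - w| := by
      have hnum : z.num ≠ w.num := fun h =>
        hne (Rat.ext h ((hden z hz).trans (hden w hw).symm))
      have h1 : (1 : ℤ) ≤ |z.num - w.num| := Int.one_le_abs (sub_ne_zero.2 hnum)
      have h2 : ((z.num : ℚ) - w.num) = (z - w) * e := by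
        rw [← Rat.mul_den_eq_num z, ← Rat.mul_den_eq_num w, hden z hz, hden w hw]; ring
      have h3 : (1 : ℚ) ≤ |(z - w) * e| := by
        rw [← h2]; exact_mod_cast h1
      rw [abs_mul, Nat.abs_cast, mul_comm] at h3
      have h4 : ((1 : ℚ) : ℝ) ≤ ((e * |z - w| : ℚ) : ℝ) := by exact_mod_cast h3
      rw [Rat.cast_one, Rat.cast_mul, Rat.cast_natCast, Rat.cast_abs, Rat.cast_sub] at h4
      exact h4
    have hfin : Λ ^ 3 ≤ 2 * R * e := by
      have he0 : (0 : ℝ) < e := by exact_mod_cast he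
      have : Λ ^ 3 * 1 ≤ Λ ^ 3 * (e * |(z : ℝ) - w|) :=
        mul_le_mul_of_nonneg_left hsep (by positivity)
      calc Λ ^ 3 = Λ ^ 3 * 1 := (mul_one _).symm
        _ ≤ e * (Λ ^ 3 * |(z : ℝ) - w|) := by linarith
        _ ≤ e * (2 * R) := mul_le_mul_of_nonneg_left (le_trans hchain hup) he0.le
        _ = 2 * R * e := by ring
    have hce' : (e : ℝ) < |(c : ℝ)| := by
      rw [← Rat.cast_abs]; exact_mod_cast hce
    have hc' : (2 : ℝ) ^ (d + 3) ≤ |(c : ℝ)| := by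
      rw [← Rat.cast_abs]; exact_mod_cast hc
    exact caseB_numeric hd hR0 hRd hc' (by exact_mod_cast he) hce' hfin
  calc (ratPreperiodicPts d c).encard ≤ (univ : Set (Bool × Bool × Bool)).encard :=
        encard_le_encard_of_injOn (mapsTo_univ ι _) hinj
    _ = 8 := by
        rw [encard_univ, ENat.card_eq_coe_fintype_card]
        rfl

/-! ### The main case: the abc step (§8, Prop. 8.4 and the proof of Thm. 1.2) -/

/-- `|num q| = |q| · den q` in `ℚ`. [folklore] -/
theorem natAbs_num_eq_abs_mul_den (q : ℚ) : ((q.num.natAbs : ℕ) : ℚ) = |q| * q.den := by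
  rw [Nat.cast_natAbs, Int.cast_abs, ← Rat.mul_den_eq_num, abs_mul, Nat.abs_cast]

/-- The abc inequality for a vanishing sum of three nonzero integers `U + V + W = 0` with
`gcd(U, V) = 1`: `|W| < C · rad(UVW)^{1+ε}` (after taking absolute values one of `|U|, |V|,
|W|` is the sum of the other two, and `|W|` is at most that sum). [folklore] -/
theorem abc_int {ε C : ℝ}
    (habc : ∀ a b c : ℕ, IsABCTriple a b c → (c : ℝ) < C * ((rad a b c : ℕ) : ℝ) ^ (1 + ε))
    {U V W : ℤ} (hU : U ≠ 0) (hV : V ≠ 0) (hW : W ≠ 0) (hsum : U + V + W = 0)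
    (hcop : Int.gcd U V = 1) :
    (W.natAbs : ℝ) < C * ((radical (U * V * W).natAbs : ℕ) : ℝ) ^ (1 + ε) := by
  set p := U.natAbs with hp'
  set q := V.natAbs with hq'
  set r := W.natAbs with hr'
  have hp : 0 < p := Int.natAbs_pos.2 hU
  have hq : 0 < q := Int.natAbs_pos.2 hV
  have hr : 0 < r := Int.natAbs_pos.2 hW
  have hpq : Nat.Coprime p q := by
    rw [Nat.Coprime, hp', hq', ← Int.gcd_eq_natAbs]; exact hcop
  have hprod : (U * V * W).natAbs = p * q * r := by
    simp only [Int.natAbs_mul, hp', hq', hr']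
  have htri : p + q = r ∨ p + r = q ∨ q + r = p := by
    rcases Int.natAbs_eq U with hU' | hU' <;> rcases Int.natAbs_eq V with hV' | hV' <;>
      rcases Int.natAbs_eq W with hW' | hW' <;> omega
  rw [hprod]
  rcases htri with h | h | h
  · have := habc p q r ⟨hp, hq, h, hpq⟩
    rwa [rad_def] at this
  · have hpr : Nat.Coprime p r := by
      rw [← h] at hpq
      exact Nat.coprime_self_add_right.1 hpq
    have := habc p r q ⟨hp, hr, h, hpr⟩
    rw [rad_def] at this
    have hrq : (r : ℝ) ≤ q := by exact_mod_cast (h ▸ Nat.le_add_left r p : r ≤ q)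
    calc (r : ℝ) ≤ q := hrq
      _ < C * ((radical (p * r * q) : ℕ) : ℝ) ^ (1 + ε) := this
      _ = C * ((radical (p * q * r) : ℕ) : ℝ) ^ (1 + ε) := by rw [mul_right_comm]
  · have hqr : Nat.Coprime q r := by
      rw [← h] at hpq
      exact Nat.coprime_comm.1 (Nat.coprime_self_add_left.1 hpq)
    have := habc q r p ⟨hq, hr, h, hqr⟩
    rw [rad_def] at this
    have hrp : (r : ℝ) ≤ p := by exact_mod_cast (h ▸ Nat.le_add_left r q : r ≤ p)
    calc (r : ℝ) ≤ p := hrp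
      _ < C * ((radical (q * r * p) : ℕ) : ℝ) ^ (1 + ε) := this
      _ = C * ((radical (p * q * r) : ℕ) : ℝ) ^ (1 + ε) := by
          rw [show q * r * p = p * q * r by ring]

/-- **The abc step** (Looper 2021, Prop. 8.4 and p. 21: abc applied to the projective point `P =
(p₁^d : p₂^d : f(p₁) − f(p₂))` on the line `Z₁ − Z₂ = Z₃`), over `ℚ` and after clearing the
common denominator and the gcd: if `y₁ ^ d − y₂ ^ d = e^{d−1} w` with nonzero integers `y₁,
y₂, w`, `gcd(y₁, y₂) = 1`, then abc with exponent `1 + ε` and constant `C` gives `e^{d−1}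
|w| < C · (|y₁| |y₂| e |w|)^{1+ε}`, using `rad(y₁^d y₂^d e^{d−1} w) ≤ |y₁| |y₂| e |w|` (the
bound `rad(P) ≤ rad(p₁) + rad(p₂) + rad(f(p₁) − f(p₂)) + h(c)/d` of (radbound), p. 21).
[cite: Looper2021, Prop. 8.4 and §8 (proof of Thm. 1.2, (radbound))] -/
theorem abc_pow_sub_pow {ε C : ℝ} (hε : 0 ≤ ε) (hC : 0 < C)
    (habc : ∀ a b c : ℕ, IsABCTriple a b c → (c : ℝ) < C * ((rad a b c : ℕ) : ℝ) ^ (1 + ε))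
    {d : ℕ} (hd : 1 ≤ d) {e : ℕ} (he : 0 < e) {y₁ y₂ w : ℤ} (hy₁ : y₁ ≠ 0) (hy₂ : y₂ ≠ 0)
    (hw : w ≠ 0) (hcop : Int.gcd y₁ y₂ = 1) (hrel : y₁ ^ d - y₂ ^ d = (e : ℤ) ^ (d - 1) * w) :
    (e : ℝ) ^ (d - 1) * (w.natAbs : ℝ) <
      C * ((y₁.natAbs : ℝ) * y₂.natAbs * e * w.natAbs) ^ (1 + ε) := by
  set U : ℤ := y₁ ^ d with hU
  set V : ℤ := -(y₂ ^ d) with hV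
  set W : ℤ := -((e : ℤ) ^ (d - 1) * w) with hW
  have hU0 : U ≠ 0 := pow_ne_zero _ hy₁
  have hV0 : V ≠ 0 := neg_ne_zero.2 (pow_ne_zero _ hy₂)
  have he0 : (e : ℤ) ≠ 0 := by exact_mod_cast he.ne'
  have hW0 : W ≠ 0 := neg_ne_zero.2 (mul_ne_zero (pow_ne_zero _ he0) hw)
  have hsum : U + V + W = 0 := by rw [hV, hW]; linear_combination hrel
  have hcopUV : Int.gcd U V = 1 := by
    have h1 : IsCoprime y₁ y₂ := Int.isCoprime_iff_gcd_eq_one.2 hcop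
    have h2 : IsCoprime U V := (h1.pow (m := d) (n := d)).neg_right
    exact Int.isCoprime_iff_gcd_eq_one.1 h2
  have key := abc_int habc hU0 hV0 hW0 hsum hcopUV
  have hWabs : W.natAbs = e ^ (d - 1) * w.natAbs := by
    rw [hW, Int.natAbs_neg, Int.natAbs_mul, Int.natAbs_pow, Int.natAbs_natCast]
  have hprod : (U * V * W).natAbs = y₁.natAbs ^ d * y₂.natAbs ^ d * (e ^ (d - 1) * w.natAbs) := by
    rw [Int.natAbs_mul, Int.natAbs_mul, hWabs, hU, hV, Int.natAbs_neg, Int.natAbs_pow,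
      Int.natAbs_pow]
  set Y : ℕ := y₁.natAbs * y₂.natAbs * e * w.natAbs with hY
  have hY0 : Y ≠ 0 := by
    rw [hY]; exact Nat.mul_ne_zero (Nat.mul_ne_zero (Nat.mul_ne_zero
      (Int.natAbs_ne_zero.2 hy₁) (Int.natAbs_ne_zero.2 hy₂)) he.ne') (Int.natAbs_ne_zero.2 hw)
  have hdvd : (U * V * W).natAbs ∣ Y ^ d := by
    rw [hprod, hY]
    have hY' : (y₁.natAbs * y₂.natAbs * e * w.natAbs) ^ d =
        y₁.natAbs ^ d * y₂.natAbs ^ d * (e ^ d * w.natAbs ^ d) := by ring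
    rw [hY']
    exact mul_dvd_mul_left _
      (mul_dvd_mul (pow_dvd_pow e (by omega)) (dvd_pow_self _ (by omega)))
  have hrad : radical (U * V * W).natAbs ≤ Y := radical_le_of_dvd_pow hY0 hdvd
  have hradR : ((radical (U * V * W).natAbs : ℕ) : ℝ) ^ (1 + ε) ≤ (Y : ℝ) ^ (1 + ε) :=
    Real.rpow_le_rpow (Nat.cast_nonneg _) (by exact_mod_cast hrad) (by linarith)
  have hYR : (Y : ℝ) = (y₁.natAbs : ℝ) * y₂.natAbs * e * w.natAbs := by
    rw [hY]; push_cast; ring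
  rw [hWabs] at key
  push_cast at key
  calc (e : ℝ) ^ (d - 1) * (w.natAbs : ℝ)
      < C * ((radical (U * V * W).natAbs : ℕ) : ℝ) ^ (1 + ε) := key
    _ ≤ C * (Y : ℝ) ^ (1 + ε) := mul_le_mul_of_nonneg_left hradR hC.le
    _ = C * ((y₁.natAbs : ℝ) * y₂.natAbs * e * w.natAbs) ^ (1 + ε) := by rw [hYR]

/-- The relation behind the triple `P = (p₁^d : p₂^d : f(p₁) − f(p₂))` of Looper 2021, Prop.
8.4, over `ℚ` in numerators: if all rational preperiodic points of `f = z ^ d + c` have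
denominator `e`, then for two of them `x₁/e, x₂/e` with images `x₁'/e, x₂'/e` one has `x₁^d
− x₂^d = e^{d−1} (x₁' − x₂')` in `ℤ`. [cite: Looper2021, Prop. 8.4] -/
theorem num_pow_sub_num_pow_eq {d : ℕ} (hd : 1 ≤ d) {c : ℚ} {e : ℕ}
    (hden : ∀ z ∈ ratPreperiodicPts d c, z.den = e)
    {z₁ z₂ : ℚ} (hz₁ : z₁ ∈ ratPreperiodicPts d c) (hz₂ : z₂ ∈ ratPreperiodicPts d c) :
    z₁.num ^ d - z₂.num ^ d =
      (e : ℤ) ^ (d - 1) * ((unicritical d c z₁).num - (unicritical d c z₂).num) := by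
  have hx₁ : z₁ * e = z₁.num := by rw [← hden z₁ hz₁]; exact Rat.mul_den_eq_num z₁
  have hx₂ : z₂ * e = z₂.num := by rw [← hden z₂ hz₂]; exact Rat.mul_den_eq_num z₂
  have hf₁ : unicritical d c z₁ ∈ ratPreperiodicPts d c := IsPreperiodicPt.apply hz₁
  have hf₂ : unicritical d c z₂ ∈ ratPreperiodicPts d c := IsPreperiodicPt.apply hz₂
  have hx₁' : (z₁ ^ d + c) * e = (unicritical d c z₁).num := by
    rw [← unicritical_apply d c z₁, ← hden _ hf₁]; exact Rat.mul_den_eq_num _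
  have hx₂' : (z₂ ^ d + c) * e = (unicritical d c z₂).num := by
    rw [← unicritical_apply d c z₂, ← hden _ hf₂]; exact Rat.mul_den_eq_num _
  have hpow : (e : ℚ) ^ d = (e : ℚ) ^ (d - 1) * e := by rw [← pow_succ]; congr 1; omega
  have key : ((z₁.num : ℚ)) ^ d - (z₂.num : ℚ) ^ d =
      (e : ℚ) ^ (d - 1) * (((unicritical d c z₁).num : ℚ) - (unicritical d c z₂).num) := by
    rw [← hx₁, ← hx₂, ← hx₁', ← hx₂', mul_pow, mul_pow, hpow]; ring
  exact_mod_cast key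

/-- When the common denominator is `≥ 2`, no rational preperiodic point is `0`. [folklore] -/
theorem num_ne_zero_of_mem {d : ℕ} {c : ℚ} {e : ℕ} (he2 : 2 ≤ e)
    (hden : ∀ z ∈ ratPreperiodicPts d c, z.den = e) {z : ℚ} (hz : z ∈ ratPreperiodicPts d c) :
    z.num ≠ 0 := by
  intro h
  have hz0 : z = 0 := Rat.num_eq_zero.1 h
  have := hden z hz
  rw [hz0] at this
  simp at this
  omega

/-- Height bound for numerators in the main case (Looper 2021, Lemma 8.2: `h(p_i) ≤ h(c)/d + log
2`): if `c = a/e^d` with `|a| ≤ e^{d+1}` then every rational preperiodic point `x/e` has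
`|x| ^ d ≤ 2^d e^{d+1}`. [cite: Looper2021, Lemma 8.2] -/
theorem natAbs_num_pow_le_of_mem {d : ℕ} (hd : 2 ≤ d) {c : ℚ} {e : ℕ} (he : 1 ≤ e)
    (hden : ∀ z ∈ ratPreperiodicPts d c, z.den = e) (ha : c.num.natAbs ≤ e ^ (d + 1))
    {z : ℚ} (hz : z ∈ ratPreperiodicPts d c) : z.num.natAbs ^ d ≤ 2 ^ d * e ^ (d + 1) := by
  have h2d : 2 ≤ 2 ^ d := by
    calc 2 = 2 ^ 1 := by norm_num
      _ ≤ 2 ^ d := Nat.pow_le_pow_right (by norm_num) (by omega)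
  rcases natAbs_num_pow_le_or_of_mem_ratPreperiodicPts hd hz with h | h
  · calc z.num.natAbs ^ d ≤ 2 * c.num.natAbs := h
      _ ≤ 2 * e ^ (d + 1) := Nat.mul_le_mul_left 2 ha
      _ ≤ 2 ^ d * e ^ (d + 1) := Nat.mul_le_mul_right _ h2d
  · rw [hden z hz] at h
    calc z.num.natAbs ^ d ≤ (2 * e) ^ d := Nat.pow_le_pow_left h d
      _ = 2 ^ d * e ^ d := mul_pow 2 e d
      _ ≤ 2 ^ d * e ^ (d + 1) :=
          Nat.mul_le_mul_left _ (Nat.pow_le_pow_right he (by omega))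

/-- **Data of the main case.** If `c = a/e^d` with `e ≥ 2`, `|a| ≤ e^{d+1}`, and `z₁ ≠ ±z₂` are
rational preperiodic points of `f = z^d + c`, then writing `z_i = g y_i / e` with `gcd(y₁,
y₂) = 1` one gets nonzero integers with `y₁^d − y₂^d = e^{d−1} w` (the gcd `g` is prime to
`e`, so `g^d` divides `x₁' − x₂'`; this division by the gcd replaces the coprimality Lemma
8.3 of the source, which is why no restriction to points of a common cycle — and hence no
appeal to Doyle–Poonen — is needed over `ℚ`), together with the height bounds `|y_i|^d ≤ 2^d
e^{d+1}` (Lemma 8.2) and `|w| ≤ 2M`, `M^d ≤ 2^d e^{d+1}` (`h(p₁ − p₂) ≤ h(c)/d + log 4`,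
Lemma 8.2). [cite: Looper2021, Lemmas 8.2, 8.3 and Prop. 8.4] -/
theorem caseA_data {d : ℕ} (hd : 2 ≤ d) {c : ℚ} {e : ℕ} (he2 : 2 ≤ e)
    (hden : ∀ z ∈ ratPreperiodicPts d c, z.den = e) (ha : c.num.natAbs ≤ e ^ (d + 1))
    {z₁ z₂ : ℚ} (hz₁ : z₁ ∈ ratPreperiodicPts d c) (hz₂ : z₂ ∈ ratPreperiodicPts d c)
    (hne : z₁ ≠ z₂) (hne' : z₁ ≠ -z₂) :
    ∃ (y₁ y₂ w : ℤ) (M : ℕ), y₁ ≠ 0 ∧ y₂ ≠ 0 ∧ w ≠ 0 ∧ Int.gcd y₁ y₂ = 1 ∧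
      y₁ ^ d - y₂ ^ d = (e : ℤ) ^ (d - 1) * w ∧
      y₁.natAbs ^ d ≤ 2 ^ d * e ^ (d + 1) ∧ y₂.natAbs ^ d ≤ 2 ^ d * e ^ (d + 1) ∧
      1 ≤ M ∧ M ^ d ≤ 2 ^ d * e ^ (d + 1) ∧ w.natAbs ≤ 2 * M := by
  have he1 : 1 ≤ e := by omega
  set f := unicritical d c with hf
  set x₁ := z₁.num with hx₁
  set x₂ := z₂.num with hx₂
  have hf₁ : f z₁ ∈ ratPreperiodicPts d c := IsPreperiodicPt.apply hz₁
  have hf₂ : f z₂ ∈ ratPreperiodicPts d c := IsPreperiodicPt.apply hz₂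
  set x₁' := (f z₁).num with hx₁'
  set x₂' := (f z₂).num with hx₂'
  have hx₁0 : x₁ ≠ 0 := num_ne_zero_of_mem he2 hden hz₁
  have hx₂0 : x₂ ≠ 0 := num_ne_zero_of_mem he2 hden hz₂
  have hx₁'0 : x₁' ≠ 0 := num_ne_zero_of_mem he2 hden hf₁
  have hx₂'0 : x₂' ≠ 0 := num_ne_zero_of_mem he2 hden hf₂
  -- the relation
  have hrel := num_pow_sub_num_pow_eq (d := d) (by omega) hden hz₁ hz₂
  rw [← hx₁, ← hx₂] at hrel
  -- t ≠ 0
  set t : ℤ := x₁' - x₂' with ht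
  have ht0 : t ≠ 0 := by
    intro h0
    have hfeq : f z₁ = f z₂ :=
      Rat.ext (sub_eq_zero.1 h0) ((hden _ hf₁).trans (hden _ hf₂).symm)
    have hpow : z₁ ^ d = z₂ ^ d := by
      have := hfeq; simp only [hf, unicritical_apply, add_left_inj] at this; exact this
    rcases (pow_eq_pow_iff_of_ne_zero (by omega : d ≠ 0)).1 hpow with h | ⟨h, -⟩
    · exact hne h
    · exact hne' h
  -- gcd decomposition
  obtain ⟨g, y₁, y₂, hg, hcop, h₁, h₂⟩ :=
    Int.exists_gcd_one' (Int.gcd_pos_of_ne_zero_left x₂ hx₁0)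
  have hg0 : (g : ℤ) ≠ 0 := by exact_mod_cast hg.ne'
  have hy₁0 : y₁ ≠ 0 := by rintro rfl; rw [zero_mul] at h₁; exact hx₁0 h₁
  have hy₂0 : y₂ ≠ 0 := by rintro rfl; rw [zero_mul] at h₂; exact hx₂0 h₂
  -- g coprime to e
  have hge : Nat.Coprime g e := by
    have hred : Nat.Coprime x₁.natAbs e := by
      have := z₁.reduced; rwa [hden z₁ hz₁] at this
    have hgdvd : g ∣ x₁.natAbs := by
      rw [h₁, Int.natAbs_mul, Int.natAbs_natCast]; exact dvd_mul_left _ _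
    exact Nat.Coprime.coprime_dvd_left hgdvd hred
  have hcopZ : IsCoprime ((g : ℤ) ^ d) ((e : ℤ) ^ (d - 1)) := by
    apply IsCoprime.pow
    rw [Int.isCoprime_iff_gcd_eq_one, Int.gcd_natCast_natCast]
    exact hge
  -- g^d ∣ t
  have hrel' : (g : ℤ) ^ d * (y₁ ^ d - y₂ ^ d) = (e : ℤ) ^ (d - 1) * t := by
    rw [← hrel, h₁, h₂, mul_pow, mul_pow]; ring
  have hdvd : (g : ℤ) ^ d ∣ t := by
    apply hcopZ.dvd_of_dvd_mul_left
    rw [← hrel']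
    exact dvd_mul_right _ _
  obtain ⟨w, hw⟩ := hdvd
  have hw0 : w ≠ 0 := by rintro rfl; rw [mul_zero] at hw; exact ht0 hw
  have hrelw : y₁ ^ d - y₂ ^ d = (e : ℤ) ^ (d - 1) * w := by
    apply mul_left_cancel₀ (pow_ne_zero d hg0)
    rw [hrel', hw]; ring
  -- bounds
  have hb₁ := natAbs_num_pow_le_of_mem hd he1 hden ha hz₁
  have hb₂ := natAbs_num_pow_le_of_mem hd he1 hden ha hz₂
  have hb₁' := natAbs_num_pow_le_of_mem hd he1 hden ha hf₁
  have hb₂' := natAbs_num_pow_le_of_mem hd he1 hden ha hf₂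
  rw [← hx₁] at hb₁
  rw [← hx₂] at hb₂
  rw [← hx₁'] at hb₁'
  rw [← hx₂'] at hb₂'
  have hy₁le : y₁.natAbs ≤ x₁.natAbs := by
    rw [h₁, Int.natAbs_mul, Int.natAbs_natCast]; exact Nat.le_mul_of_pos_right _ hg
  have hy₂le : y₂.natAbs ≤ x₂.natAbs := by
    rw [h₂, Int.natAbs_mul, Int.natAbs_natCast]; exact Nat.le_mul_of_pos_right _ hg
  set M : ℕ := max x₁'.natAbs x₂'.natAbs with hM
  have hM1 : 1 ≤ M := le_trans (Int.natAbs_pos.2 hx₁'0) (le_max_left _ _)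
  have hMd : M ^ d ≤ 2 ^ d * e ^ (d + 1) := by
    rcases max_choice x₁'.natAbs x₂'.natAbs with h | h <;> rw [hM, h]
    · exact hb₁'
    · exact hb₂'
  have hwle : w.natAbs ≤ 2 * M := by
    have h1 : w.natAbs ≤ t.natAbs := by
      rw [hw, Int.natAbs_mul, Int.natAbs_pow, Int.natAbs_natCast]
      exact Nat.le_mul_of_pos_left _ (pow_pos hg d)
    have h2 : t.natAbs ≤ x₁'.natAbs + x₂'.natAbs := Int.natAbs_sub_le _ _
    have h3 : x₁'.natAbs ≤ M := le_max_left _ _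
    have h4 : x₂'.natAbs ≤ M := le_max_right _ _
    omega
  exact ⟨y₁, y₂, w, M, hy₁0, hy₂0, hw0, hcop, hrelw,
    le_trans (Nat.pow_le_pow_left hy₁le d) hb₁, le_trans (Nat.pow_le_pow_left hy₂le d) hb₂,
    hM1, hMd, hwle⟩

/-- Logarithmic form of `n ^ d ≤ 2 ^ d · e ^ (d+1)`: `d log n ≤ d log 2 + (d+1) log e`.
[folklore] -/
theorem dlog_le_of_pow_le {n d e : ℕ} (hn : 1 ≤ n) (he : 1 ≤ e)
    (h : n ^ d ≤ 2 ^ d * e ^ (d + 1)) :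
    (d : ℝ) * Real.log n ≤ d * Real.log 2 + (d + 1) * Real.log e := by
  have h' : (n : ℝ) ^ d ≤ 2 ^ d * (e : ℝ) ^ (d + 1) := by exact_mod_cast h
  have hn' : (0 : ℝ) < n := by exact_mod_cast hn
  have he' : (0 : ℝ) < e := by exact_mod_cast he
  have hl := Real.log_le_log (by positivity) h'
  rw [Real.log_pow, Real.log_mul (by positivity) (by positivity), Real.log_pow, Real.log_pow] at hl
  push_cast at hl
  linarith

/-- **The height inequality of the main case** (Looper 2021, p. 21: `h(P) − (1+ε) rad(P) ≥
((d−4−ξ−4ε)/d) h(c) − (1+2ε) log 4 − η`, positive for `d ≥ 5` and small `ε, ξ`), in the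
logarithmic variables of this file with `ε = 1/10`: from the abc inequality `(d−1)·le + lw <
LC + 1.1 (l₁ + l₂ + le + lw)` and the height bounds `d·lᵢ ≤ d·L2 + (d+1)·le`, `d·lw ≤ 2d·L2
+ (d+1)·le` one gets `(d² − 4.4d − 2.3)·le < d (LC + 2.4 L2)`, and `d² − 4.4 d − 2.3 ≥ 0.7`
for `d ≥ 5`. [cite: Looper2021, §8 (proof of Thm. 1.2, d ≥ 5)] -/
theorem caseA_arith {d : ℕ} (hd : 5 ≤ d) {LC L2 le l1 l2 lw : ℝ} (he : 0 ≤ le)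
    (habc : ((d : ℝ) - 1) * le + lw < LC + (1 + 1 / 10 : ℝ) * (l1 + l2 + le + lw))
    (hb1 : (d : ℝ) * l1 ≤ d * L2 + (d + 1) * le) (hb2 : (d : ℝ) * l2 ≤ d * L2 + (d + 1) * le)
    (hbw : (d : ℝ) * lw ≤ 2 * d * L2 + (d + 1) * le) :
    (7 / 10 : ℝ) * le < d * (LC + (24 / 10 : ℝ) * L2) := by
  have hd' : (5 : ℝ) ≤ d := by exact_mod_cast hd
  have h1 := mul_lt_mul_of_pos_left habc (by linarith : (0 : ℝ) < d)
  have h2 : 0 ≤ ((d : ℝ) - 5) * ((d : ℝ) + 6 / 10) * le :=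
    mul_nonneg (mul_nonneg (by linarith) (by linarith)) he
  nlinarith [h1, h2, hb1, hb2, hbw]

/-- **The main case** (Looper 2021, Prop. 8.4 and the proof of Thm. 1.2 for `d ≥ 5`, p. 21, over
`ℚ`): assume abc with exponent `1 + 1/10` and constant `C`. If `d ≥ 5`, `c = a/e^d` with `e
≥ 2` and `|a| ≤ e^{d+1}` (the archimedean place does not dominate), and `z^d + c` has two
rational preperiodic points `z₁ ≠ ±z₂`, then `0.7 · log e < d (log C + 2.4 log 2)`: the
denominator, hence `h(c)`, is bounded in terms of `d` and `C` only. [cite: Looper2021, Prop.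
8.4 and Thm. 1.2 (proof, d ≥ 5)] -/
theorem log_den_lt_of_abc {d : ℕ} (hd : 5 ≤ d) {C : ℝ} (hC : 0 < C)
    (habc : ∀ a b c : ℕ, IsABCTriple a b c →
      (c : ℝ) < C * ((rad a b c : ℕ) : ℝ) ^ (1 + (1 / 10 : ℝ)))
    {c : ℚ} {e : ℕ} (he2 : 2 ≤ e) (hden : ∀ z ∈ ratPreperiodicPts d c, z.den = e)
    (ha : c.num.natAbs ≤ e ^ (d + 1)) {z₁ z₂ : ℚ} (hz₁ : z₁ ∈ ratPreperiodicPts d c)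
    (hz₂ : z₂ ∈ ratPreperiodicPts d c) (hne : z₁ ≠ z₂) (hne' : z₁ ≠ -z₂) :
    (7 / 10 : ℝ) * Real.log e < d * (Real.log C + (24 / 10 : ℝ) * Real.log 2) := by
  have hd2 : 2 ≤ d := by omega
  have hd1 : 1 ≤ d := by omega
  have he1 : 1 ≤ e := by omega
  obtain ⟨y₁, y₂, w, M, hy₁, hy₂, hw, hcop, hrel, hb₁, hb₂, hM1, hMd, hwM⟩ :=
    caseA_data hd2 he2 hden ha hz₁ hz₂ hne hne'
  have key := abc_pow_sub_pow (ε := 1 / 10) (by norm_num) hC habc hd1 (by omega) hy₁ hy₂ hw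
    hcop hrel
  -- logs
  have hy₁1 : 1 ≤ y₁.natAbs := Int.natAbs_pos.2 hy₁
  have hy₂1 : 1 ≤ y₂.natAbs := Int.natAbs_pos.2 hy₂
  have hw1 : 1 ≤ w.natAbs := Int.natAbs_pos.2 hw
  have heR : (1 : ℝ) ≤ e := by exact_mod_cast he1
  have hy₁R : (1 : ℝ) ≤ y₁.natAbs := by exact_mod_cast hy₁1
  have hy₂R : (1 : ℝ) ≤ y₂.natAbs := by exact_mod_cast hy₂1
  have hwR : (1 : ℝ) ≤ w.natAbs := by exact_mod_cast hw1
  have hMR : (1 : ℝ) ≤ M := by exact_mod_cast hM1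
  have hl1 := dlog_le_of_pow_le hy₁1 he1 hb₁
  have hl2 := dlog_le_of_pow_le hy₂1 he1 hb₂
  have hlM := dlog_le_of_pow_le hM1 he1 hMd
  -- lw bound
  have hlw : (d : ℝ) * Real.log w.natAbs ≤ 2 * d * Real.log 2 + (d + 1) * Real.log e := by
    have h1 : (w.natAbs : ℝ) ≤ 2 * M := by exact_mod_cast hwM
    have h2 : Real.log w.natAbs ≤ Real.log 2 + Real.log M := by
      rw [← Real.log_mul (by norm_num) (by positivity)]
      exact Real.log_le_log (by positivity) h1
    have h3 : (d : ℝ) * Real.log w.natAbs ≤ d * (Real.log 2 + Real.log M) :=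
      mul_le_mul_of_nonneg_left h2 (Nat.cast_nonneg d)
    linarith
  -- abc in logs
  have hlhs : 0 < (e : ℝ) ^ (d - 1) * (w.natAbs : ℝ) := by positivity
  have hY : 0 < (y₁.natAbs : ℝ) * y₂.natAbs * e * w.natAbs := by positivity
  have hlog := Real.log_lt_log hlhs key
  rw [Real.log_mul (by positivity) (by positivity), Real.log_pow,
    Real.log_mul (by positivity) (by positivity), Real.log_rpow hY,
    Real.log_mul (by positivity) (by positivity), Real.log_mul (by positivity) (by positivity),
    Real.log_mul (by positivity) (by positivity)] at hlog
  have hcast : ((d - 1 : ℕ) : ℝ) = (d : ℝ) - 1 := by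
    rw [Nat.cast_sub hd1]; simp
  rw [hcast] at hlog
  exact caseA_arith hd (Real.log_nonneg heR) hlog hl1 hl2 hlw

/-! ### Assembly -/

/-- Box count: if all rational preperiodic points of `z ^ d + c` have denominator `e ≤ N` and
`|c| ≤ N` (`N ≥ 1`), there are at most `4N² + 1` of them (`|z| ≤ 2N` by the archimedean
box). [folklore] -/
theorem encard_le_box {d : ℕ} (hd : 2 ≤ d) {c : ℚ} {e N : ℕ} (hN : 1 ≤ N)
    (hden : ∀ z ∈ ratPreperiodicPts d c, z.den = e) (heN : e ≤ N) (hcN : |c| ≤ N) :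
    (ratPreperiodicPts d c).encard ≤ (4 * N ^ 2 + 1 : ℕ) := by
  have hT : ∀ z ∈ ratPreperiodicPts d c, |z| ≤ 2 * (N : ℚ) := by
    intro z hz
    have hN' : (1 : ℚ) ≤ N := by exact_mod_cast hN
    rcases abs_pow_le_or_abs_le_of_mem_ratPreperiodicPts hd hz with h | h
    · have h1 : |z| ^ d ≤ (2 * (N : ℚ)) ^ d := by
        calc |z| ^ d ≤ 2 * |c| := h
          _ ≤ 2 * N := by linarith
          _ = (2 * (N : ℚ)) ^ 1 := (pow_one _).symm
          _ ≤ (2 * (N : ℚ)) ^ d := pow_le_pow_right₀ (by linarith) (by omega)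
      exact (pow_le_pow_iff_left₀ (abs_nonneg z) (by positivity) (by omega)).1 h1
    · linarith
  have h := encard_ratPreperiodicPts_le_of_abs_le hden hT
  refine le_trans h ?_
  have hfl : ⌊2 * (N : ℚ) * e⌋₊ ≤ 2 * N * N := by
    have : ⌊2 * (N : ℚ) * e⌋₊ = 2 * N * e := by
      rw [show (2 * (N : ℚ) * e) = ((2 * N * e : ℕ) : ℚ) by push_cast; ring, Nat.floor_natCast]
    rw [this]
    exact Nat.mul_le_mul_left _ heN
  exact_mod_cast (by nlinarith [hfl] : 2 * ⌊2 * (N : ℚ) * e⌋₊ + 1 ≤ 4 * N ^ 2 + 1)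

/-- `|c| = |num c| / e^d` when `e` is the common denominator of the rational preperiodic points
of `z ^ d + c`. [folklore] -/
theorem abs_eq_natAbs_div_pow {d : ℕ} (hd : 2 ≤ d) {c : ℚ} {e : ℕ} {z : ℚ}
    (hz : z ∈ ratPreperiodicPts d c) (hden : z.den = e) :
    |c| = (c.num.natAbs : ℚ) / (e : ℚ) ^ d := by
  have h1 := natAbs_num_eq_abs_mul_den c
  have h2 := den_pow_eq_den_of_mem_ratPreperiodicPts hd hz
  rw [hden] at h2
  have he0 : (e : ℚ) ≠ 0 := by rw [← hden]; exact_mod_cast z.den_nz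
  rw [h1, ← h2, Nat.cast_pow, mul_div_assoc, div_self (pow_ne_zero _ he0), mul_one]

end Looper2021

open Looper2021 in
/-- **Looper 2021, Theorem 1.2 for `K = ℚ`, `d ≥ 5`** — discharge of the named fact
`looper2021`: the abc conjecture over `ℚ` (Masser–Oesterlé form, any `ε > 0`) implies that for
each `d ≥ 5` the unicritical family `z ↦ z ^ d + c`, `c ∈ ℚ`, has uniformly boundedly many
rational preperiodic points. Proof (see the module docstring for the dictionary with the
source): abc is used with `ε = 1/10`; with `e` the common denominator of the preperiodic points
and `c = a/e^d`, either `|a| ≤ e^{d+1}` (main case, `log_den_lt_of_abc`: `e ≤ E₀(d, C)` and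
`|c| ≤ e`, then the box count), or `|a| > e^{d+1}` and `|c| < 2^{d+3}` (box count again), or
`|a| > e^{d+1}`, `|c| ≥ 2^{d+3}` (the easier case, at most `8` points). The bound is
`B = max 8 (4 N₀² + 1)`, `N₀ = max(⌈exp(d (log C + 2.4 log 2)/0.7)⌉, 2^{d+3}, 1)`.
[cite: Looper2021, Thm. 1.2 (K = ℚ, d ≥ 5)] -/
theorem looper2021_holds : looper2021 := by
  intro d hd habc
  have hd2 : 2 ≤ d := by omega
  obtain ⟨C, hC, habcC⟩ := habc (1 / 10) (by norm_num)
  set L₀ : ℝ := d * (Real.log C + (24 / 10 : ℝ) * Real.log 2) / (7 / 10) with hL₀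
  set E₀ : ℕ := ⌈Real.exp L₀⌉₊ with hE₀
  set N₀ : ℕ := max (max E₀ (2 ^ (d + 3))) 1 with hN₀
  have hN₀1 : 1 ≤ N₀ := le_max_right _ _
  have hE₀N : E₀ ≤ N₀ := le_trans (le_max_left _ _) (le_max_left _ _)
  have h2N : 2 ^ (d + 3) ≤ N₀ := le_trans (le_max_right _ _) (le_max_left _ _)
  refine ⟨max 8 (4 * N₀ ^ 2 + 1), fun c => ?_⟩
  have hbox : ∀ {e : ℕ}, (∀ z ∈ ratPreperiodicPts d c, z.den = e) → e ≤ N₀ → |c| ≤ N₀ →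
      (ratPreperiodicPts d c).encard ≤ ((max 8 (4 * N₀ ^ 2 + 1) : ℕ) : ℕ∞) := by
    intro e hden heN hcN
    exact le_trans (encard_le_box hd2 hN₀1 hden heN hcN) (by exact_mod_cast le_max_right _ _)
  have h8 : (8 : ℕ∞) ≤ ((max 8 (4 * N₀ ^ 2 + 1) : ℕ) : ℕ∞) := by exact_mod_cast le_max_left _ _
  by_cases h3 : (ratPreperiodicPts d c).encard ≤ 2
  · exact le_trans h3 (le_trans (by norm_num) h8)
  push Not at h3
  -- three distinct points
  have h3' : (3 : ℕ∞) ≤ (ratPreperiodicPts d c).encard := by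
    have := Order.add_one_le_of_lt h3
    norm_num at this
    exact this
  obtain ⟨t, htP, ht3⟩ := exists_subset_encard_eq h3'
  obtain ⟨x, y, u, hxy, hxu, hyu, rfl⟩ := encard_eq_three.1 ht3
  have hx : x ∈ ratPreperiodicPts d c := htP (by simp)
  have hy : y ∈ ratPreperiodicPts d c := htP (by simp)
  have hu : u ∈ ratPreperiodicPts d c := htP (by simp)
  -- a good pair
  obtain ⟨z₁, z₂, hz₁, hz₂, hne, hne'⟩ : ∃ z₁ z₂, z₁ ∈ ratPreperiodicPts d c ∧
      z₂ ∈ ratPreperiodicPts d c ∧ z₁ ≠ z₂ ∧ z₁ ≠ -z₂ := by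
    by_cases hyx : x = -y
    · refine ⟨x, u, hx, hu, hxu, fun h => hyu ?_⟩
      rw [hyx, neg_inj] at h
      -- h : y = u? careful: x = -y and x = -u gives -y = -u
      exact h
    · exact ⟨x, y, hx, hy, hxy, hyx⟩
  -- common denominator
  set e : ℕ := x.den with he
  have hden : ∀ z ∈ ratPreperiodicPts d c, z.den = e :=
    fun z hz => den_eq_den_of_mem_ratPreperiodicPts hd2 hz hx
  have he1 : 1 ≤ e := x.den_pos
  have hce : |c| = (c.num.natAbs : ℚ) / (e : ℚ) ^ d := abs_eq_natAbs_div_pow hd2 hx rfl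
  have heQ : (0 : ℚ) < e := by exact_mod_cast he1
  by_cases hA : c.num.natAbs ≤ e ^ (d + 1)
  · -- Case A
    have hcle : |c| ≤ e := by
      rw [hce, div_le_iff₀ (by positivity)]
      calc (c.num.natAbs : ℚ) ≤ ((e ^ (d + 1) : ℕ) : ℚ) := by exact_mod_cast hA
        _ = e * (e : ℚ) ^ d := by push_cast; ring
    rcases (show e = 1 ∨ 2 ≤ e by omega) with he_one | he2
    · apply hbox hden (by omega)
      calc |c| ≤ e := hcle
        _ = 1 := by exact_mod_cast he_one
        _ ≤ N₀ := by exact_mod_cast hN₀1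
    · have hlog := log_den_lt_of_abc hd hC habcC he2 hden hA hz₁ hz₂ hne hne'
      have hlt : Real.log e < L₀ := by
        rw [hL₀, lt_div_iff₀ (by norm_num)]; linarith
      have heE : e ≤ E₀ := by
        have h1 : (e : ℝ) < Real.exp L₀ := by
          calc (e : ℝ) = Real.exp (Real.log e) := (Real.exp_log (by positivity)).symm
            _ < Real.exp L₀ := Real.exp_lt_exp.2 hlt
        have h2 : (e : ℝ) ≤ E₀ := le_trans h1.le (Nat.le_ceil _)
        exact_mod_cast h2
      apply hbox hden (le_trans heE hE₀N)
      calc |c| ≤ e := hcle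
        _ ≤ N₀ := by exact_mod_cast le_trans heE hE₀N
  · -- Case B
    push Not at hA
    have hclt : (e : ℚ) < |c| := by
      rw [hce, lt_div_iff₀ (by positivity)]
      calc (e : ℚ) * (e : ℚ) ^ d = ((e ^ (d + 1) : ℕ) : ℚ) := by push_cast; ring
        _ < c.num.natAbs := by exact_mod_cast hA
    by_cases hB : (2 : ℚ) ^ (d + 3) ≤ |c|
    · exact le_trans (encard_ratPreperiodicPts_le_eight hd he1 hden hclt hB) h8
    · push Not at hB
      have hcN : |c| ≤ N₀ := by
        calc |c| ≤ (2 : ℚ) ^ (d + 3) := hB.le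
          _ = ((2 ^ (d + 3) : ℕ) : ℚ) := by push_cast; ring
          _ ≤ N₀ := by exact_mod_cast h2N
      have heN : e ≤ N₀ := by
        have : (e : ℚ) ≤ N₀ := le_trans hclt.le hcN
        exact_mod_cast this
      exact hbox hden heN hcN

end Literature.NumberTheory.DiophantineGeometry
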